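import Literature.MathematicalPhysics.QuantumFieldTheory.Federbush1986.LatticeGeometry

/-!
# Federbush, *A phase cell approach to Yang–Mills theory. IV. The choice of variables* (CMP **114** (1988) 317–343) —
# §1 «Preliminaries, Notation, and Definitions», pp. 321–325: couplings (1.1), the hierarchy of lattices `ℒ^r` of edge size
# `1/N^r`, blocks of `N⁴` vertices with CENTRAL base points and the identification `ℬ^r ↔ 𝒱^{r−1}`, radial trees `t_v`, `t_b`,
# `t_{v₁v₂}`, field configurations (1.2), the edge classes and the disjoint union (1.4), the actions (1.5)–(1.9); p. 336: height,
# `r`-planes, depth, on-`r`/off-`r`; p. 338: hypercubes of level `r`, their centres, the «Centering Property» — TYPED with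
# bodies, the structural sentences PROVED

statement-level skeleton of published theorems with citation tags; proofs where landed; nothing here is a claim about the Yang–Mills mass gap

Cell `lit-balaban`, reader/typer block **r19** (F4 fold owner), inventory rows `F4.Def§1` (§1 Preliminaries) and `F4.Def§11`
(p. 336 definitions, p. 338 Centering Property) of `run/shared/lean/pub/lit-balaban/lit-balaban-r19/ROWS-F4.md`; companion of
`PhaseCellIVGaugeInterpolation` (§11) and of r17's `LatticeGeometry` (F-III §5.4 radial maximal trees: `latticeGraph`,
`IsMaximalTree`, `IsRadial`, which print's «universal tree `T_UN` … "radial" as defined in [4]» cites).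

**Source.** P. Federbush, Commun. Math. Phys. **114** (1988) 317–343 [bib `Federbush1988PhaseCellIV`; doi:10.1007/bf01225039;
lit store `paper:doi-10-1007-bf01225039`; journal page = PDF page + 316], pp. 321–325 [PDF 5–9], 336 [PDF 20], 338 [PDF 22]
READ AS IMAGES (renders `lit-balaban-r19/renders/f4/f4-p005.png` … `f4-p009.png`, `f4-p020.png`, `f4-p022.png`).  Verbatim:

* p. 321: «We work in four dimensions.  There are three parameters in our model, `g₀`, the coupling (at level `0`), `N`, (the
  block spin transformation is for blocks of size `N⁴`), `a`, the measure of plaquette variable smallness. … We work with a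
  Lie group, `G`.  The levels or scale sizes are labelled by a parameter `r`, `r = 0, 1, 2, …`.  The edge size at scale `r` is
  `1/N^r`.  If `r₂ > r₁` we say level `r₂` is lower scale (level), or finer scale (level), or smaller scale (level) than `r₁`.
  For each scale `r` there is a lattice, `ℒ^r`.  We associate to `ℒ^r` the *coupling constant* `g_r`,
  `1/g_r² = 1/g₀² + Ar + B ln(r+1)`. (1.1)»
* p. 322: «The set of *plaquettes* of `ℒ^r` we denote as `𝒫^r`, the set of *edges* of `ℒ^r` as `ℰ^r`, the *vertices* of `ℒ^r`
  as `𝒱^r`.  The vertices of `ℒ^r` are grouped into *blocks* of size `N⁴`, the set of blocks in `ℒ^r` is called `ℬ^r`.  Each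
  block `b` in `ℬ^r` has a *basepoint* `v` in `𝒱^r`.  We write `v = b*` and `b = v*`. … If `b` is in `ℬ^r`, then `b*` is
  identified with a vertex in `𝒱^{r−1}`.  This gives a 1–1 identification between elements of `ℬ^r` and `𝒱^{r−1}`.  We will
  choose `N` odd, and pick the base point of each block to be its central vertex.  We are given a *universal tree*, `T_UN`, on
  `Z⁴` that is maximal (passing through every vertex) and "radial" as defined in [4]. … If `v` is a vertex in `𝒱^r`, we let
  `t_v` be the *radial tree* at `v`, a translate and scaling of `T_UN`, that brings the origin in `Z⁴` to `v` and scales by a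
  factor `1/N^r`.  If `b` is in `ℬ^r`, we let `t_b` be the radial tree at `b*`, restricted to `b`. … If `v₁` and `v₂` are in
  `𝒱^r` we write `t_{v₁v₂}` for the portion of `t_{v₁}` connecting `v₁` and `v₂` (this is a unique path from `v₁` to `v₂`). …
  A *field configuration*, or a *Yang–Mills field*, `𝓕`, is an assignment to each oriented edge of each lattice of an element
  of `G`, say `g(e)` to edge `e`.  If `e′` is `e` with the opposite orientation we must have `g(e′) = g⁻¹(e)` … for `e ∈ ℰ^r`,
  `g(e)` must be the appropriate block spin transformation (as defined in [4]) of the assignments `g(e_i)`, `e_i ∈ ℰ^{r+1}`. …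
  The block spin transformation may then be viewed as a mapping `BS_r : 𝓕^r → 𝓕^{r−1}`. (1.2)  Mathematically the field `𝓕`
  is a point in the inverse limit of the system `{𝓕^r, BS_r}`.»
* p. 323: «There are `N³` edges that join `b₁` and `b₂` …  We call these *channel edges*, and their union `ℰ_C^{r+1}` …  Edges
  inside blocks … are called *block edges*, their union `ℰ_B^{r+1}`.  Note `ℰ_B^r ∪ ℰ_C^r = ℰ^r`, `ℰ_B^r ∩ ℰ_C^r = ∅`.  In each
  channel we select a distinguished channel edge, and call it an *averaging edge* …, the union of these `ℰ_A^{r+1}`.  We call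
  the edges in each block `b` that lie in `t_b` the *identity edges*, their union `ℰ_I^{r+1}`.  We set `ℰ_BM^r = ℰ_B^r − ℰ_I^r`,
  and `ℰ_CM^r = ℰ_C^r − ℰ_A^r`. …  We note the disjoint union `ℰ = ℰ_A ∪ ℰ_BM ∪ ℰ_CM ∪ ℰ_I`. (1.4)»
* p. 324: «For the action on the `r`th lattice, `ℒ^r`, we take `(1/g_r²) S₀^r`, where `S₀^r = ¼ Σ_{p∈𝒫^r} f(A_∂p)`. (1.5) …
  The total action is given as `S = (1/g₀²) S₀⁰ + Σ_{r=1} ((1/g_r²) S₀^r − (1/g_{r−1}²) S₀^{r−1}) = S_R + S_0`, (1.6) where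
  `S_R = Σ_{r=1} (1/g_r² − 1/g_{r−1}²) S₀^{r−1}`, (1.8)  `S_0 = (1/g₀²) S₀⁰ + Σ₁ (1/g_r²)(S₀^r − S₀^{r−1})`. (1.9)  `S_R` is
  viewed as the *renormalization counter terms*.  `S_0` may be viewed as the unrenormalized action.» (there is no (1.7))
* p. 336: «The *height* of a vertex `v` (in any `𝒱^{r′}`) is the highest level, `r`, for which `v ∈ 𝒱^r` (under our
  identifications).  We now define an *r-plane*.  A plane is an *r-plane* if it contains some `p ∈ 𝒫^r` (`p` and the plane
  viewed as lying in `R⁴`).  A geometric object, in `R⁴`, is of *depth* `r` if it intersects some `r`-plane, and no `r′`-plane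
  with `r′ < r`.  A geometric object is *off-r* if it intersects no `r`-plane, and *on-r* if it does.  Thus an object is of
  depth `r` if it is on-`r` but off-`r′` for `r′ < r`.»
* p. 338: «*Centering Property.* With `H` level `r`, `d(x₀, c(H)) ≤ L_{r+1}`, if `H′` is any cube that contains `x₀`, with
  level `H′ = r′ ≥ r`, then `d(x₀, c(H′)) ≤ L_{r′+1}`, where `c(H_i)` is the center of `H_i`.»

**What this file does.**  Everything in dimension `d` (print: `d = 4`) with block parameter `N = 2M + 1` (print: «`N` odd»):
* §1 (1.1) `invCouplingSq`; §2 `edgeLen N r = 1/N^r`, the vertex positions `pos N r n = n/N^r ∈ ℝᵈ` of `𝒱^r` indexed by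
  `n ∈ ℤᵈ`, the identification `pos N (r+1) (N·n) = pos N r n` and the nesting `𝒱^r ⊆ 𝒱^{r+1}` (PROVED); §3 blocks with
  CENTRAL base points: `blockOf M n` (the block of the level-`r` vertex `n`), `basePt M m = N·m` (the base point `b*` of the
  block labelled by the level-`(r−1)` vertex `m` — «1–1 identification between `ℬ^r` and `𝒱^{r−1}`»), `blockOf_eq_iff`
  (`|n_i − N m_i| ≤ M`), `blockEquiv` (each block has exactly `N^d` vertices, PROVED); §4 radial trees `radialTreeAt T v`
  (= `t_v`, a tree iff `T` is), `blockTree` (= `t_b`), `treePath` (= `t_{v₁v₂}`, the unique path), chains `t(v₁, …, v_n)`;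
  §5 field configurations with `g(−e) = g(e)⁻¹` and (1.2) as a compatibility predicate for an abstract block spin map;
  §6 block / channel edges (`IsBlockEdge`; a channel edge joins ADJACENT blocks, PROVED; the channel `m → m + e_μ` has
  exactly `N^{d−1}` edges — print's «`N³` edges that join `b₁` and `b₂`», PROVED via `channelEquiv`), identity and averaging
  edges as the two chosen subfamilies, `ℰ_BM`, `ℰ_CM` and the disjoint union (1.4) (PROVED), modes with home edge / pinning
  vertex / level (p. 323–324), pure modes vs `A`-modes; §7 the actions (1.5), (1.6), (1.8), (1.9) for a finite
  number of levels with (1.6) `S = S_R + S_0` and the telescoped form `S = (1/g_R²) S₀^R` PROVED; §8 p. 336: `IsRPlane`, `OnR`,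
  `OffR`, `HasDepth`, `HasHeight` (an `r`-plane is an `(r+1)`-plane, PROVED); §9 p. 338: level-`r` hypercubes `cube N r n`,
  centres `center N r n`, the «Centering Property», and — consistent with «We will choose `N` odd» — the centre `c(H)` itself
  HAS the Centering Property when `N` is odd (`centeringProperty_center`, PROVED: `c(H)` is the centre of the unique
  level-`r′` cube containing it, for every `r′ ≥ r`).
No new `Prop`-facts without proof except the abstract compatibility predicates, which are definitions; no `sorry`.
-/

namespace Literature.MathematicalPhysics.QuantumFieldTheory.Federbush1986

noncomputable section

open Set Metric

namespace PhaseCellIVLattice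

open RadialTree

variable {d : ℕ}

/-! ## 1. (1.1) the couplings `g_r` -/

/-- **(1.1)** p. 321: «We associate to `ℒ^r` the *coupling constant* `g_r`, `1/g_r² = 1/g₀² + Ar + B ln(r+1)`» — the inverse
square coupling at level `r` as a function of the three numbers `g₀`, `A`, `B`. [cite: Federbush1988PhaseCellIV, (1.1) p. 321] -/
def invCouplingSq (g₀ A B : ℝ) (r : ℕ) : ℝ := 1 / g₀ ^ 2 + A * r + B * Real.log (r + 1)

/-- At level `0`, (1.1) returns `1/g₀²` («`g₀`, the coupling (at level `0`)»). [cite: Federbush1988PhaseCellIV, (1.1) p. 321] -/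
@[simp] theorem invCouplingSq_zero (g₀ A B : ℝ) : invCouplingSq g₀ A B 0 = 1 / g₀ ^ 2 := by
  simp [invCouplingSq]

/-- The increments of (1.1): `1/g_{r+1}² − 1/g_r² = A + B(ln(r+2) − ln(r+1))` (the coefficients of `S_R` in (1.8)).
[cite: Federbush1988PhaseCellIV, (1.1) p. 321; (1.8) p. 324] -/
theorem invCouplingSq_succ_sub (g₀ A B : ℝ) (r : ℕ) :
    invCouplingSq g₀ A B (r + 1) - invCouplingSq g₀ A B r = A + B * (Real.log (r + 2) - Real.log (r + 1)) := by
  simp only [invCouplingSq, Nat.cast_add, Nat.cast_one]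
  ring_nf

/-! ## 2. The lattices `ℒ^r`: edge size `1/N^r`, vertices `𝒱^r = N^{−r}ℤᵈ ⊂ ℝᵈ`, nesting -/

/-- «The edge size at scale `r` is `1/N^r`» (= `L_r` of §11). [cite: Federbush1988PhaseCellIV, §1 p. 321] -/
def edgeLen (N r : ℕ) : ℝ := ((N : ℝ) ^ r)⁻¹

/-- `L_0 = 1` («one may take a single cube as the lattice at level `0`»). [cite: Federbush1988PhaseCellIV, §1 p. 321] -/
@[simp] theorem edgeLen_zero (N : ℕ) : edgeLen N 0 = 1 := by simp [edgeLen]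

/-- `L_{r+1} = L_r / N`. [cite: Federbush1988PhaseCellIV, §1 p. 321] -/
theorem edgeLen_succ (N r : ℕ) : edgeLen N (r + 1) = edgeLen N r / N := by
  simp [edgeLen, pow_succ, mul_comm, div_eq_mul_inv]

/-- `L_r > 0` for `N ≥ 1`. [cite: Federbush1988PhaseCellIV, §1 p. 321] -/
theorem edgeLen_pos {N : ℕ} (hN : 0 < N) (r : ℕ) : 0 < edgeLen N r := by
  have : (0 : ℝ) < N := by exact_mod_cast hN
  simp [edgeLen, this]

/-- The position in `ℝᵈ` of the vertex of `𝒱^r` with integer label `n ∈ ℤᵈ`: `n/N^r` (print identifies «vertices in different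
`𝒱^r` that occupy the same point in `R⁴`», p. 336). [cite: Federbush1988PhaseCellIV, §1 p. 321–322; §11 p. 336] -/
def pos (N r : ℕ) (n : Fin d → ℤ) : EuclideanSpace ℝ (Fin d) := WithLp.toLp 2 fun i => (n i : ℝ) * edgeLen N r

/-- Coordinates of a vertex position. [cite: Federbush1988PhaseCellIV, §1 p. 321–322] -/
@[simp] theorem pos_apply (N r : ℕ) (n : Fin d → ℤ) (i : Fin d) : pos N r n i = (n i : ℝ) * edgeLen N r := rfl

/-- `𝒱^r`, the vertex set of `ℒ^r` as a subset of `ℝᵈ`. [cite: Federbush1988PhaseCellIV, §1 p. 322] -/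
def vertices (d N r : ℕ) : Set (EuclideanSpace ℝ (Fin d)) := range (pos (d := d) N r)

/-- THE IDENTIFICATION between levels: the level-`(r+1)` vertex labelled `N·n` occupies the same point of `ℝᵈ` as the
level-`r` vertex labelled `n` («`b*` is identified with a vertex in `𝒱^{r−1}`», p. 322; «under our identifications», p. 336).
[cite: Federbush1988PhaseCellIV, §1 p. 322; §11 p. 336] -/
theorem pos_succ_smul {N : ℕ} (hN : 0 < N) (r : ℕ) (n : Fin d → ℤ) : pos N (r + 1) ((N : ℤ) • n) = pos N r n := by
  ext i
  have hN' : (N : ℝ) ≠ 0 := by exact_mod_cast hN.ne'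
  simp only [pos_apply, Pi.smul_apply, smul_eq_mul, Int.cast_mul, Int.cast_natCast, edgeLen, pow_succ, mul_inv]
  field_simp

/-- Hence `𝒱^r ⊆ 𝒱^{r+1}` as point sets (the coarse lattice is a sublattice of the fine one).
[cite: Federbush1988PhaseCellIV, §1 p. 321–322; §11 p. 336] -/
theorem vertices_subset_succ {N : ℕ} (hN : 0 < N) (r : ℕ) : vertices d N r ⊆ vertices d N (r + 1) := by
  rintro _ ⟨n, rfl⟩
  exact ⟨(N : ℤ) • n, pos_succ_smul hN r n⟩

/-- … and `𝒱^r ⊆ 𝒱^{r′}` for all `r ≤ r′`. [cite: Federbush1988PhaseCellIV, §1 p. 321–322; §11 p. 336] -/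
theorem vertices_mono {N : ℕ} (hN : 0 < N) {r r' : ℕ} (h : r ≤ r') : vertices d N r ⊆ vertices d N r' := by
  induction h with
  | refl => exact Subset.rfl
  | step _ ih => exact ih.trans (vertices_subset_succ hN _)

/-! ## 3. Blocks of `N^d` vertices with central base points (`N = 2M + 1`); `ℬ^r ↔ 𝒱^{r−1}` -/

/-- The block of the level-`r` vertex `n`, labelled by the level-`(r−1)` vertex `m` whose image `N·m` is the block's CENTRAL
base point: `m_i = ⌊(n_i + M)/N⌋`, `N = 2M+1` («We will choose `N` odd, and pick the base point of each block to be its central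
vertex», p. 322). [cite: Federbush1988PhaseCellIV, §1 p. 322] -/
def blockOf (M : ℕ) (n : Fin d → ℤ) : Fin d → ℤ := fun i => (n i + M) / (2 * M + 1 : ℕ)

/-- The base point `b*` of the block labelled `m`, as a level-`r` vertex: `N·m` — the «1–1 identification between elements of
`ℬ^r` and `𝒱^{r−1}`» is `m ↦ N·m` (cf. `pos_succ_smul`). [cite: Federbush1988PhaseCellIV, §1 p. 322] -/
def basePt (M : ℕ) (m : Fin d → ℤ) : Fin d → ℤ := ((2 * M + 1 : ℕ) : ℤ) • m

/-- A vertex `n` lies in the block labelled `m` iff it is within `M` of the base point `N·m` in every coordinate — so the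
blocks are the cubes of `N^d` vertices CENTRED at their base points. [cite: Federbush1988PhaseCellIV, §1 p. 322] -/
theorem blockOf_eq_iff {M : ℕ} {n m : Fin d → ℤ} :
    blockOf M n = m ↔ ∀ i, -(M : ℤ) ≤ n i - (2 * M + 1 : ℕ) * m i ∧ n i - (2 * M + 1 : ℕ) * m i ≤ M := by
  have hN : (0 : ℤ) < (2 * M + 1 : ℕ) := by positivity
  simp only [funext_iff, blockOf]
  refine forall_congr' fun i => ?_
  rw [Int.ediv_eq_iff_of_pos hN]
  push_cast
  constructor <;> rintro ⟨h1, h2⟩ <;> constructor <;> linarith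

/-- The base point lies in its own block: `blockOf (N·m) = m`. [cite: Federbush1988PhaseCellIV, §1 p. 322] -/
@[simp] theorem blockOf_basePt (M : ℕ) (m : Fin d → ℤ) : blockOf M (basePt M m) = m := by
  rw [blockOf_eq_iff]
  intro i
  simp [basePt]

/-- The «1–1 identification»: `m ↦ b* = N·m` is injective. [cite: Federbush1988PhaseCellIV, §1 p. 322] -/
theorem basePt_injective (M : ℕ) : Function.Injective (basePt (d := d) M) := fun m m' h => by
  simpa using congrArg (blockOf M) h

/-- Under the identification of levels, the base point of the block `m` of `ℬ^{r+1}` IS the vertex `m` of `𝒱^r`.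
[cite: Federbush1988PhaseCellIV, §1 p. 322] -/
theorem pos_basePt (M r : ℕ) (m : Fin d → ℤ) : pos (2 * M + 1) (r + 1) (basePt M m) = pos (2 * M + 1) r m :=
  pos_succ_smul (by omega) r m

/-- The vertices of the block labelled `m` correspond to the offsets `s ∈ {−M, …, M}^d` from the base point: `n = N·m + s`
(«blocks of size `N⁴`»). [cite: Federbush1988PhaseCellIV, §1 p. 322] -/
def blockEquiv (M : ℕ) (m : Fin d → ℤ) : {n : Fin d → ℤ // blockOf M n = m} ≃ (Fin d → Icc (-(M : ℤ)) M) where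
  toFun n := fun i => ⟨n.1 i - (2 * M + 1 : ℕ) * m i, by
    have h := (blockOf_eq_iff.mp n.2) i
    exact ⟨h.1, h.2⟩⟩
  invFun s := ⟨fun i => (2 * M + 1 : ℕ) * m i + (s i : ℤ), by
    rw [blockOf_eq_iff]
    intro i
    have h := (s i).2
    constructor <;> simp only [add_sub_cancel_left] <;> [exact h.1; exact h.2]⟩
  left_inv n := by ext i; simp
  right_inv s := by ext i; simp

/-- «blocks of size `N⁴`»: every block of `ℒ^r` has exactly `N^d` vertices (`d = 4` in print).
[cite: Federbush1988PhaseCellIV, §1 p. 322] -/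
theorem card_block (M : ℕ) (m : Fin d → ℤ) : Nat.card {n : Fin d → ℤ // blockOf M n = m} = (2 * M + 1) ^ d := by
  rw [Nat.card_congr (blockEquiv M m), Nat.card_eq_fintype_card, Fintype.card_pi, Finset.prod_const, Finset.card_univ,
    Fintype.card_fin]
  congr 1
  rw [Fintype.card_ofFinset, Int.card_Icc]
  omega

/-! ## 4. Radial trees `t_v`, `t_b`, the paths `t_{v₁v₂}` and the chains `t(v₁, …, v_n)` -/

/-- «If `v` is a vertex in `𝒱^r`, we let `t_v` be the *radial tree* at `v`, a translate and scaling of `T_UN`, that brings the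
origin in `Z⁴` to `v` and scales by a factor `1/N^r`» — on vertex labels the scaling is invisible and `t_v` is the translate
of `T` by `v`: `a ~ b` in `t_v` iff `a − v ~ b − v` in `T`. (`T_UN`: a maximal radial tree of `ℤ⁴`, r17's
`LatticeGeometry.IsMaximalTree` / `IsRadial`, cited by print as «[4]» = F-III §5.4.) [cite: Federbush1988PhaseCellIV, §1 p. 322] -/
def radialTreeAt (T : SimpleGraph (Fin d → ℤ)) (v : Fin d → ℤ) : SimpleGraph (Fin d → ℤ) := T.comap fun x => x - v

/-- Adjacency in `t_v`. [cite: Federbush1988PhaseCellIV, §1 p. 322] -/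
@[simp] theorem radialTreeAt_adj (T : SimpleGraph (Fin d → ℤ)) (v a b : Fin d → ℤ) :
    (radialTreeAt T v).Adj a b ↔ T.Adj (a - v) (b - v) := Iff.rfl

/-- `t_v` is isomorphic to `T` (translation by `v`). [cite: Federbush1988PhaseCellIV, §1 p. 322] -/
def radialTreeAtIso (T : SimpleGraph (Fin d → ℤ)) (v : Fin d → ℤ) : radialTreeAt T v ≃g T where
  toEquiv := Equiv.subRight v
  map_rel_iff' := Iff.rfl

/-- `t_v` is a (maximal) tree whenever `T_UN` is. [cite: Federbush1988PhaseCellIV, §1 p. 322] -/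
theorem radialTreeAt_isTree {T : SimpleGraph (Fin d → ℤ)} (hT : T.IsTree) (v : Fin d → ℤ) : (radialTreeAt T v).IsTree :=
  (radialTreeAtIso T v).isTree_iff.mpr hT

/-- `t_v` lies in the nearest-neighbour lattice whenever `T_UN` does (translations preserve lattice edges).
[cite: Federbush1988PhaseCellIV, §1 p. 322] -/
theorem radialTreeAt_le_latticeGraph {T : SimpleGraph (Fin d → ℤ)} (hT : T ≤ latticeGraph d) (v : Fin d → ℤ) :
    radialTreeAt T v ≤ latticeGraph d := by
  intro a b hab
  have h := hT ((radialTreeAt_adj T v a b).mp hab)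
  simp only [latticeGraph, SimpleGraph.fromRel_adj, ne_eq, sub_left_inj, Pi.sub_apply, sub_sub_sub_cancel_right] at h ⊢
  exact h

/-- «If `b` is in `ℬ^r`, we let `t_b` be the radial tree at `b*`, restricted to `b`»: the subgraph of `t_{b*}` induced on the
vertices of the block labelled `m` (base point `N·m`). [cite: Federbush1988PhaseCellIV, §1 p. 322] -/
def blockTree (M : ℕ) (T : SimpleGraph (Fin d → ℤ)) (m : Fin d → ℤ) : SimpleGraph {n : Fin d → ℤ // blockOf M n = m} :=
  (radialTreeAt T (basePt M m)).induce {n | blockOf M n = m}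

/-- «we write `t_{v₁v₂}` for the portion of `t_{v₁}` connecting `v₁` and `v₂` (this is a unique path from `v₁` to `v₂`)»: the
path, and its uniqueness. [cite: Federbush1988PhaseCellIV, §1 p. 322] -/
def treePath {T : SimpleGraph (Fin d → ℤ)} (hT : T.IsTree) (v₁ v₂ : Fin d → ℤ) : (radialTreeAt T v₁).Path v₁ v₂ :=
  ((radialTreeAt_isTree hT v₁).1 v₁ v₂).some.toPath

/-- Uniqueness of `t_{v₁v₂}`: it is the only path from `v₁` to `v₂` in `t_{v₁}`. [cite: Federbush1988PhaseCellIV, §1 p. 322] -/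
theorem treePath_unique {T : SimpleGraph (Fin d → ℤ)} (hT : T.IsTree) (v₁ v₂ : Fin d → ℤ)
    (p : (radialTreeAt T v₁).Path v₁ v₂) : p = treePath hT v₁ v₂ :=
  (radialTreeAt_isTree hT v₁).2.path_unique p _

/-- «the path `t(v₁, v₂, v₃, …, v_n)` … made up of `t_{v₁v₂}, t_{v₂v₃}, …, t_{v_{n−1}v_n}`.  (In `t_{v_i,v_{i+1}}` one views `v_i`
and `v_{i+1}` as in `𝒱^{r+i−1}`.)» — the chain as the list of its single-level segments: the input lists the consecutive pairs
`(v_i, v_{i+1})`, each pair written with the labels of the lattice `𝒱^{r+i−1}` in which its segment lives (a base point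
`v_i = b_i*` of `ℬ^{r+i−1}` has label `N·m` there and label `m` in `𝒱^{r+i−2}`, `pos_basePt`).
[cite: Federbush1988PhaseCellIV, §1 p. 322] -/
def chainSegments {T : SimpleGraph (Fin d → ℤ)} (hT : T.IsTree) :
    List ((Fin d → ℤ) × (Fin d → ℤ)) → List (Σ a b : Fin d → ℤ, (radialTreeAt T a).Path a b)
  | [] => []
  | (a, b) :: l => ⟨a, b, treePath hT a b⟩ :: chainSegments hT l

/-- The chain has one segment per consecutive pair. [cite: Federbush1988PhaseCellIV, §1 p. 322] -/
@[simp] theorem length_chainSegments {T : SimpleGraph (Fin d → ℤ)} (hT : T.IsTree) (l : List ((Fin d → ℤ) × (Fin d → ℤ))) :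
    (chainSegments hT l).length = l.length := by
  induction l with
  | nil => rfl
  | cons p l ih => obtain ⟨a, b⟩ := p; simp [chainSegments, ih]

/-! ## 5. Field configurations and (1.2) -/

/-- The field configuration AT SCALE `r`, `𝓕^r`: «an assignment to each oriented edge … of an element of `G`, say `g(e)` to edge
`e`.  If `e′` is `e` with the opposite orientation we must have `g(e′) = g⁻¹(e)`».  Oriented edges of `ℒ^r` are ordered pairs
of lattice-adjacent vertex labels; `g` is recorded on all ordered pairs, the orientation rule on the lattice edges.
[cite: Federbush1988PhaseCellIV, §1 p. 322] -/
structure ScaleConfig (d : ℕ) (G : Type*) [Group G] where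
  /-- `g(e)` for the oriented edge `e = (a → b)`. -/
  g : (Fin d → ℤ) → (Fin d → ℤ) → G
  /-- «`g(e′) = g⁻¹(e)`» for `e′ = −e`. -/
  inv : ∀ a b, (latticeGraph d).Adj a b → g b a = (g a b)⁻¹

/-- A *field configuration* `𝓕`: one `𝓕^r` for every scale `r`, COMPATIBLE with the block spin transformations
`BS_r : 𝓕^r → 𝓕^{r−1}` (1.2) — «for `e ∈ ℰ^r`, `g(e)` must be the appropriate block spin transformation (as defined in [4]) of
the assignments `g(e_i)`, `e_i ∈ ℰ^{r+1}`» — i.e. «a point in the inverse limit of the system `{𝓕^r, BS_r}`».  The block spin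
maps are a PARAMETER (print takes them from F-III [4]). [cite: Federbush1988PhaseCellIV, (1.2) p. 322] -/
structure FieldConfig (d : ℕ) (G : Type*) [Group G] (BS : ℕ → ScaleConfig d G → ScaleConfig d G) where
  /-- `𝓕^r`. -/
  scale : ℕ → ScaleConfig d G
  /-- (1.2): `𝓕^r = BS_{r+1}(𝓕^{r+1})` for every `r` (inverse-limit compatibility). -/
  compat : ∀ r, scale r = BS (r + 1) (scale (r + 1))

/-- A field configuration is determined by its fine scales: `𝓕^r` is recovered from `𝓕^{r+k}` by iterating the block spin
maps («`𝓕^∞` may be viewed as the field configuration on the imaginary finest lattice»). [cite: Federbush1988PhaseCellIV,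
(1.2) p. 322] -/
theorem FieldConfig.scale_eq_iterate {G : Type*} [Group G] {BS : ℕ → ScaleConfig d G → ScaleConfig d G}
    (F : FieldConfig d G BS) (r k : ℕ) :
    F.scale r = (List.range k).foldr (fun j c => BS (r + j + 1) c) (F.scale (r + k)) := by
  induction k generalizing r with
  | zero => simp
  | succ k ih =>
    rw [List.range_succ, List.foldr_append, List.foldr_cons, List.foldr_nil]
    have h := ih r
    rw [F.compat (r + k)] at h
    simpa [Nat.add_assoc] using h

/-! ## 6. Block, channel, averaging, identity edges and the disjoint union (1.4) -/

/-- An (unoriented, positively directed) edge of `ℒ^{r+1}`: from the vertex labelled `n` to `n + e_μ`.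
[cite: Federbush1988PhaseCellIV, §1 p. 322–323] -/
structure LEdge (d : ℕ) where
  /-- the tail vertex label -/
  src : Fin d → ℤ
  /-- the direction -/
  dir : Fin d

/-- The head vertex `n + e_μ` of the edge `(n, μ)`. [cite: Federbush1988PhaseCellIV, §1 p. 323] -/
def LEdge.tgt (e : LEdge d) : Fin d → ℤ := e.src + Pi.single e.dir 1

/-- «Edges inside blocks … are called *block edges*, their union `ℰ_B^{r+1}`»: both end points in the same block.
[cite: Federbush1988PhaseCellIV, §1 p. 323] -/
def IsBlockEdge (M : ℕ) (e : LEdge d) : Prop := blockOf M e.src = blockOf M e.tgt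

/-- «edges that join `b₁` and `b₂` … We call these *channel edges*, and their union … `ℰ_C^{r+1}`»: the complement.
[cite: Federbush1988PhaseCellIV, §1 p. 323] -/
def IsChannelEdge (M : ℕ) (e : LEdge d) : Prop := blockOf M e.src ≠ blockOf M e.tgt

/-- «Note `ℰ_B ∪ ℰ_C = ℰ`, `ℰ_B ∩ ℰ_C = ∅`.» [cite: Federbush1988PhaseCellIV, §1 p. 323] -/
theorem isBlockEdge_or_isChannelEdge (M : ℕ) (e : LEdge d) : IsBlockEdge M e ∨ IsChannelEdge M e := em _

/-- «`ℰ_B ∩ ℰ_C = ∅`». [cite: Federbush1988PhaseCellIV, §1 p. 323] -/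
theorem not_isBlockEdge_and_isChannelEdge (M : ℕ) (e : LEdge d) : ¬(IsBlockEdge M e ∧ IsChannelEdge M e) :=
  fun h => h.2 h.1

/-- A channel edge joins ADJACENT blocks: the block of its head is the block of its tail shifted by `e_μ` (the figure on
p. 323: «a bond (edge) `e` in `ℰ^r` joining `v₁` and `v₂` … There are `N³` edges that join `b₁` and `b₂`»).
[cite: Federbush1988PhaseCellIV, §1 p. 323] -/
theorem blockOf_tgt_of_isChannelEdge {M : ℕ} {e : LEdge d} (h : IsChannelEdge M e) :
    blockOf M e.tgt = blockOf M e.src + Pi.single e.dir 1 := by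
  set m := blockOf M e.src with hm
  have hsrc := (blockOf_eq_iff (M := M) (n := e.src) (m := m)).mp rfl
  have htgt_dir : e.tgt e.dir = e.src e.dir + 1 := by simp [LEdge.tgt]
  have htgt_ne : ∀ i, i ≠ e.dir → e.tgt i = e.src i := fun i hi => by simp [LEdge.tgt, Pi.single_eq_of_ne hi]
  have hN : (((2 * M + 1 : ℕ) : ℤ)) = 2 * M + 1 := by push_cast; ring
  -- in the direction `μ` the tail sits in the LAST layer of its block (else head and tail would share the block)
  by_cases hlast : e.src e.dir - (2 * M + 1 : ℕ) * m e.dir = M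
  · rw [blockOf_eq_iff]
    intro i
    by_cases hi : i = e.dir
    · subst hi
      rw [htgt_dir, Pi.add_apply, Pi.single_eq_same, mul_add, mul_one]
      generalize ((2 * M + 1 : ℕ) : ℤ) * m e.dir = t at hlast hN ⊢
      omega
    · rw [htgt_ne i hi, Pi.add_apply, Pi.single_eq_of_ne hi, add_zero]
      exact hsrc i
  · exfalso
    apply h
    symm
    change blockOf M e.tgt = m
    rw [blockOf_eq_iff]
    intro i
    by_cases hi : i = e.dir
    · subst hi
      rw [htgt_dir]
      have h1 := hsrc e.dir
      generalize ((2 * M + 1 : ℕ) : ℤ) * m e.dir = t at hlast h1 ⊢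
      omega
    · rw [htgt_ne i hi]
      exact hsrc i

/-- The CHANNEL from the block `m` to the adjacent block `m + e_μ`: the edges in direction `μ` whose tail lies in block `m`
and whose head lies in block `m + e_μ` (p. 323, figure: «There are `N³` edges that join `b₁` and `b₂` … We call these
*channel edges*»). [cite: Federbush1988PhaseCellIV, §1 p. 323] -/
def channel (M : ℕ) (m : Fin d → ℤ) (μ : Fin d) : Set (LEdge d) :=
  {e | e.dir = μ ∧ blockOf M e.src = m ∧ blockOf M e.tgt = m + Pi.single μ 1}

/-- Every edge of a channel is a channel edge. [cite: Federbush1988PhaseCellIV, §1 p. 323] -/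
theorem isChannelEdge_of_mem_channel {M : ℕ} {m : Fin d → ℤ} {μ : Fin d} {e : LEdge d} (h : e ∈ channel M m μ) :
    IsChannelEdge M e := by
  obtain ⟨-, h1, h2⟩ := h
  rw [IsChannelEdge, h1, h2]
  intro h3
  have := congrFun h3 μ
  simp at this

/-- Conversely every channel edge lies in the channel from the block of its tail in its own direction.
[cite: Federbush1988PhaseCellIV, §1 p. 323] -/
theorem mem_channel_of_isChannelEdge {M : ℕ} {e : LEdge d} (h : IsChannelEdge M e) :
    e ∈ channel M (blockOf M e.src) e.dir :=
  ⟨rfl, rfl, blockOf_tgt_of_isChannelEdge h⟩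

/-- The edges of the channel `m → m + e_μ` are exactly the edges in direction `μ` whose tail is a vertex of the block `m` in
its LAST layer `n_μ − N m_μ = M` (base points being central). [cite: Federbush1988PhaseCellIV, §1 p. 322–323] -/
theorem mem_channel_iff {M : ℕ} {m : Fin d → ℤ} {μ : Fin d} {e : LEdge d} :
    e ∈ channel M m μ ↔ e.dir = μ ∧ blockOf M e.src = m ∧ e.src μ - (2 * M + 1 : ℕ) * m μ = M := by
  constructor
  · rintro ⟨hμ, hm, ht⟩
    refine ⟨hμ, hm, ?_⟩
    subst hμ
    have h1 := (blockOf_eq_iff.mp hm) e.dir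
    have h2 := (blockOf_eq_iff.mp ht) e.dir
    simp only [LEdge.tgt, Pi.add_apply, Pi.single_eq_same, mul_add, mul_one] at h2
    generalize ((2 * M + 1 : ℕ) : ℤ) * m e.dir = t at h1 h2 ⊢
    omega
  · rintro ⟨hμ, hm, hlast⟩
    refine ⟨hμ, hm, ?_⟩
    subst hμ
    have hsrc := blockOf_eq_iff.mp hm
    rw [blockOf_eq_iff]
    intro i
    by_cases hi : i = e.dir
    · subst hi
      simp only [LEdge.tgt, Pi.add_apply, Pi.single_eq_same, mul_add, mul_one]
      generalize ((2 * M + 1 : ℕ) : ℤ) * m e.dir = t at hlast ⊢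
      omega
    · simp only [LEdge.tgt, Pi.add_apply, Pi.single_eq_of_ne hi, add_zero]
      exact hsrc i

/-- The channel `m → m + e_μ` is parametrised by the `d − 1` free offsets `s_i ∈ {−M, …, M}`, `i ≠ μ`, of its tail inside the
block (the offset in direction `μ` being `M`). [cite: Federbush1988PhaseCellIV, §1 p. 323] -/
def channelEquiv (M : ℕ) (m : Fin d → ℤ) (μ : Fin d) : channel M m μ ≃ ({i : Fin d // i ≠ μ} → Icc (-(M : ℤ)) M) where
  toFun e := fun i => ⟨e.1.src i - (2 * M + 1 : ℕ) * m i, by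
    have h := (blockOf_eq_iff.mp (mem_channel_iff.mp e.2).2.1) i
    exact ⟨h.1, h.2⟩⟩
  invFun s := ⟨⟨fun i => (2 * M + 1 : ℕ) * m i + (if h : i = μ then (M : ℤ) else (s ⟨i, h⟩ : ℤ)), μ⟩, by
    rw [mem_channel_iff]
    refine ⟨rfl, ?_, by simp⟩
    rw [blockOf_eq_iff]
    intro i
    by_cases hi : i = μ
    · subst hi; simp
    · have h := (s ⟨i, hi⟩).2
      simp only [dif_neg hi, add_sub_cancel_left]
      exact ⟨h.1, h.2⟩⟩
  left_inv e := by
    obtain ⟨⟨src, dir⟩, he⟩ := e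
    obtain ⟨rfl, -, hlast⟩ := mem_channel_iff.mp he
    dsimp only at hlast
    simp only [Subtype.mk.injEq, LEdge.mk.injEq, and_true]
    funext i
    by_cases hi : i = dir
    · subst hi; simp only [dif_pos]; omega
    · simp [dif_neg hi]
  right_inv s := by
    funext i
    obtain ⟨i, hi⟩ := i
    ext
    simp [dif_neg hi]

/-- «There are `N³` edges that join `b₁` and `b₂`»: every channel has exactly `N^{d−1}` edges (`d = 4`, `N³` in print).
[cite: Federbush1988PhaseCellIV, §1 p. 323] -/
theorem card_channel (M : ℕ) (m : Fin d → ℤ) (μ : Fin d) : Nat.card (channel M m μ) = (2 * M + 1) ^ (d - 1) := by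
  rw [Nat.card_congr (channelEquiv M m μ), Nat.card_eq_fintype_card, Fintype.card_pi, Finset.prod_const, Finset.card_univ]
  have h1 : Fintype.card {i : Fin d // i ≠ μ} = d - 1 := by
    rw [Fintype.card_subtype_compl, Fintype.card_fin, Fintype.card_unique]
  rw [h1]
  congr 1
  rw [Fintype.card_ofFinset, Int.card_Icc]
  omega

/-! ### Modes: home edge, pinning vertex, level (p. 323–324) -/

/-- «Each mode has associated to it, one edge and a vertex (in some `𝒱^r`), its *home edge* and *pinning vertex*. … The
*level* of a mode is the level of its home edge»: a mode is recorded by the level and the home edge.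
[cite: Federbush1988PhaseCellIV, §1 p. 323–324] -/
structure Mode (d : ℕ) where
  /-- the level `r` of the home edge -/
  level : ℕ
  /-- the home edge, an edge of `ℒ^level` -/
  home : LEdge d

/-- «Its pinning vertex is the "tail end" of its home edge.» [cite: Federbush1988PhaseCellIV, §1 p. 323] -/
def Mode.pinningVertex (μ : Mode d) : Fin d → ℤ := μ.home.src

/-- The pinning vertex as a point of `R⁴` («a vertex (in some `𝒱^r`)»). [cite: Federbush1988PhaseCellIV, §1 p. 323] -/
def Mode.pinningPoint (N : ℕ) (μ : Mode d) : EuclideanSpace ℝ (Fin d) := pos N μ.level μ.pinningVertex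

/-- The pinning point is a vertex of `𝒱^{level}`. [cite: Federbush1988PhaseCellIV, §1 p. 323] -/
theorem Mode.pinningPoint_mem (N : ℕ) (μ : Mode d) : μ.pinningPoint N ∈ vertices d N μ.level := ⟨_, rfl⟩

/-- The edge classes of (1.4), given the two CHOICES print makes: the identity edges `ℰ_I ⊆ ℰ_B` («the edges in each block `b`
that lie in `t_b`») and the averaging edges `ℰ_A ⊆ ℰ_C` («In each channel we select a distinguished channel edge»); then
`ℰ_BM = ℰ_B − ℰ_I` (block mode edges) and `ℰ_CM = ℰ_C − ℰ_A` (channel mode edges). [cite: Federbush1988PhaseCellIV, §1 p. 323] -/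
structure EdgeClasses (d M : ℕ) where
  /-- `ℰ_I`, the identity edges -/
  EI : Set (LEdge d)
  /-- `ℰ_A`, the averaging edges -/
  EA : Set (LEdge d)
  /-- identity edges are block edges (they lie in `t_b ⊆ b`) -/
  EI_block : EI ⊆ {e | IsBlockEdge M e}
  /-- averaging edges are channel edges -/
  EA_channel : EA ⊆ {e | IsChannelEdge M e}

/-- `ℰ_B`, the set of block edges. [cite: Federbush1988PhaseCellIV, §1 p. 323] -/
def blockEdges (M : ℕ) : Set (LEdge d) := {e | IsBlockEdge M e}

/-- `ℰ_C`, the set of channel edges. [cite: Federbush1988PhaseCellIV, §1 p. 323] -/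
def channelEdges (M : ℕ) : Set (LEdge d) := {e | IsChannelEdge M e}

namespace EdgeClasses

variable {M : ℕ} (C : EdgeClasses d M)

/-- «`ℰ_BM = ℰ_B − ℰ_I` … The edges in `ℰ_BM` are *block mode edges*». [cite: Federbush1988PhaseCellIV, §1 p. 323] -/
def EBM : Set (LEdge d) := blockEdges M \ C.EI

/-- «`ℰ_CM = ℰ_C − ℰ_A` … those in `ℰ_CM` are *channel mode* edges». [cite: Federbush1988PhaseCellIV, §1 p. 323] -/
def ECM : Set (LEdge d) := channelEdges M \ C.EA

/-- «There will be a pure mode associated to each edge in `ℰ_BM ∪ ℰ_CM = ℰ_P`». [cite: Federbush1988PhaseCellIV, §1 p. 323] -/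
def EP : Set (LEdge d) := C.EBM ∪ C.ECM

/-- **(1.4)** p. 323: «We note the disjoint union `ℰ = ℰ_A ∪ ℰ_BM ∪ ℰ_CM ∪ ℰ_I`» — the union is everything …
[cite: Federbush1988PhaseCellIV, (1.4) p. 323] -/
theorem union_eq_univ : C.EA ∪ C.EBM ∪ C.ECM ∪ C.EI = univ := by
  ext e
  simp only [mem_union, EBM, ECM, blockEdges, channelEdges, mem_sdiff, mem_setOf_eq, mem_univ, iff_true]
  rcases isBlockEdge_or_isChannelEdge M e with h | h <;> tauto

/-- … and the four classes are pairwise disjoint. [cite: Federbush1988PhaseCellIV, (1.4) p. 323] -/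
theorem pairwise_disjoint :
    Disjoint C.EA C.EBM ∧ Disjoint C.EA C.ECM ∧ Disjoint C.EA C.EI ∧
      Disjoint C.EBM C.ECM ∧ Disjoint C.EBM C.EI ∧ Disjoint C.ECM C.EI := by
  have hA := C.EA_channel
  have hI := C.EI_block
  simp only [disjoint_left, EBM, ECM, blockEdges, channelEdges, mem_sdiff, mem_setOf_eq]
  refine ⟨?_, ?_, ?_, ?_, ?_, ?_⟩
  · exact fun e he ⟨hb, _⟩ => (hA he) hb
  · exact fun e he ⟨_, hna⟩ => hna he
  · exact fun e he hi => (hA he) (hI hi)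
  · exact fun e ⟨hb, _⟩ ⟨hc, _⟩ => hc hb
  · exact fun e ⟨_, hni⟩ hi => hni hi
  · exact fun e ⟨hc, _⟩ hi => hc (hI hi)

/-- `ℰ_P` splits the pure modes «into channel and block modes»: `ℰ_P ∩ ℰ_B = ℰ_BM`, `ℰ_P ∩ ℰ_C = ℰ_CM`.
[cite: Federbush1988PhaseCellIV, §1 p. 323–324] -/
theorem EP_inter : C.EP ∩ blockEdges M = C.EBM ∧ C.EP ∩ channelEdges M = C.ECM := by
  constructor <;> ext e <;>
    simp only [EP, EBM, ECM, blockEdges, channelEdges, mem_inter_iff, mem_union, mem_sdiff, mem_setOf_eq,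
      IsChannelEdge] <;> tauto

/-- «Pure modes have home edges in `ℰ_P`» (a level-`(r+1)` mode whose home edge is a block mode or channel mode edge).
[cite: Federbush1988PhaseCellIV, §1 p. 324] -/
def IsPureMode (r : ℕ) (μ : Mode d) : Prop := μ.level = r + 1 ∧ μ.home ∈ C.EP

/-- «`A`-modes have home edges in `ℰ_A`, a 1–1 correspondence» (averaging correction modes).
[cite: Federbush1988PhaseCellIV, §1 p. 324] -/
def IsAMode (r : ℕ) (μ : Mode d) : Prop := μ.level = r + 1 ∧ μ.home ∈ C.EA

/-- Pure modes «split into channel and block modes by the decomposition of `ℰ_P`».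
[cite: Federbush1988PhaseCellIV, §1 p. 324] -/
theorem isPureMode_iff {r : ℕ} {μ : Mode d} :
    C.IsPureMode r μ ↔ μ.level = r + 1 ∧ (μ.home ∈ C.EBM ∨ μ.home ∈ C.ECM) := Iff.rfl

/-- No mode is both pure and an `A`-mode ((1.4) is a disjoint union). [cite: Federbush1988PhaseCellIV, (1.4) p. 323; p. 324] -/
theorem not_isPureMode_and_isAMode (r : ℕ) (μ : Mode d) : ¬(C.IsPureMode r μ ∧ C.IsAMode r μ) := by
  rintro ⟨⟨-, hP⟩, ⟨-, hA⟩⟩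
  obtain ⟨h1, h2, -, -, -, -⟩ := C.pairwise_disjoint
  rcases hP with hBM | hCM
  · exact disjoint_left.mp h1 hA hBM
  · exact disjoint_left.mp h2 hA hCM

end EdgeClasses

/-! ## 7. The actions (1.5), (1.6), (1.8), (1.9) -/

/-- **(1.5)** p. 324: «For the action on the `r`th lattice, `ℒ^r`, we take `(1/g_r²) S₀^r`, where `S₀^r = ¼ Σ_{p∈𝒫^r} f(A_∂p)`»
— for a finite family of plaquettes of `ℒ^r` with plaquette variables `A_∂p` and the single-plaquette function `f` of F-III
(3.2)–(3.4). [cite: Federbush1988PhaseCellIV, (1.5) p. 324] -/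
def plaquetteAction {P X : Type*} (plaqs : Finset P) (f : X → ℝ) (A : P → X) : ℝ := (1 / 4) * ∑ p ∈ plaqs, f (A p)

/-- **(1.6)** p. 324, the total action for the levels `0, …, R` («`S = (1/g₀²) S₀⁰ + Σ_{r=1} ((1/g_r²) S₀^r − (1/g_{r−1}²)
S₀^{r−1})`»), with `a r = 1/g_r²` and `S0 r = S₀^r`. [cite: Federbush1988PhaseCellIV, (1.6) p. 324] -/
def totalAction (a S0 : ℕ → ℝ) (R : ℕ) : ℝ :=
  a 0 * S0 0 + ∑ r ∈ Finset.range R, (a (r + 1) * S0 (r + 1) - a r * S0 r)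

/-- **(1.8)** p. 324: «`S_R = Σ_{r=1} (1/g_r² − 1/g_{r−1}²) S₀^{r−1}`» — «the *renormalization counter terms*».
[cite: Federbush1988PhaseCellIV, (1.8) p. 324] -/
def counterTerms (a S0 : ℕ → ℝ) (R : ℕ) : ℝ := ∑ r ∈ Finset.range R, (a (r + 1) - a r) * S0 r

/-- **(1.9)** p. 324: «`S_0 = (1/g₀²) S₀⁰ + Σ₁ (1/g_r²)(S₀^r − S₀^{r−1})`» — «the unrenormalized action».
[cite: Federbush1988PhaseCellIV, (1.9) p. 324] -/
def unrenormalizedAction (a S0 : ℕ → ℝ) (R : ℕ) : ℝ :=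
  a 0 * S0 0 + ∑ r ∈ Finset.range R, a (r + 1) * (S0 (r + 1) - S0 r)

/-- **(1.6)**: «`S = … = S_R + S_0`» (termwise: `a_r S_r − a_{r−1} S_{r−1} = (a_r − a_{r−1}) S_{r−1} + a_r (S_r − S_{r−1})`).
[cite: Federbush1988PhaseCellIV, (1.6), (1.8), (1.9) p. 324] -/
theorem totalAction_eq_counterTerms_add_unrenormalized (a S0 : ℕ → ℝ) (R : ℕ) :
    totalAction a S0 R = counterTerms a S0 R + unrenormalizedAction a S0 R := by
  simp only [totalAction, counterTerms, unrenormalizedAction]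
  rw [add_left_comm, ← Finset.sum_add_distrib]
  congr 1
  exact Finset.sum_congr rfl fun r _ => by ring

/-- The sum in (1.6) telescopes: for the levels `0, …, R` the total action is the finest-level action `(1/g_R²) S₀^R`.
[cite: Federbush1988PhaseCellIV, (1.6) p. 324] -/
theorem totalAction_eq_last (a S0 : ℕ → ℝ) (R : ℕ) : totalAction a S0 R = a R * S0 R := by
  simp only [totalAction]
  rw [Finset.sum_range_sub (fun r => a r * S0 r)]
  ring

/-! ## 8. p. 336: `r`-planes, on-`r` / off-`r`, depth, height -/

/-- An **`r`-plane** p. 336: «A plane is an *r-plane* if it contains some `p ∈ 𝒫^r` (`p` and the plane viewed as lying in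
`R⁴`)» — a two-dimensional coordinate plane spanned by the directions `μ ≠ ν` through a vertex of `𝒱^r`, i.e. all its other
coordinates frozen at lattice values `n_k/N^r`. [cite: Federbush1988PhaseCellIV, §11 p. 336] -/
def IsRPlane (N r : ℕ) (P : Set (EuclideanSpace ℝ (Fin d))) : Prop :=
  ∃ μ ν : Fin d, μ ≠ ν ∧ ∃ n : Fin d → ℤ, P = {x | ∀ k, k ≠ μ → k ≠ ν → x k = pos N r n k}

/-- The plaquette's own plane: the `r`-plane through the vertex `n` in the directions `μ, ν` contains that vertex.
[cite: Federbush1988PhaseCellIV, §11 p. 336] -/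
theorem pos_mem_rPlane (N r : ℕ) (n : Fin d → ℤ) (μ ν : Fin d) :
    pos N r n ∈ {x : EuclideanSpace ℝ (Fin d) | ∀ k, k ≠ μ → k ≠ ν → x k = pos N r n k} := fun _ _ _ => rfl

/-- An `r`-plane is an `(r+1)`-plane (its frozen coordinates are also level-`(r+1)` lattice values).
[cite: Federbush1988PhaseCellIV, §11 p. 336] -/
theorem IsRPlane.succ {N : ℕ} (hN : 0 < N) {r : ℕ} {P : Set (EuclideanSpace ℝ (Fin d))} (h : IsRPlane N r P) :
    IsRPlane N (r + 1) P := by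
  obtain ⟨μ, ν, hμν, n, rfl⟩ := h
  refine ⟨μ, ν, hμν, (N : ℤ) • n, ?_⟩
  simp only [pos_succ_smul hN]

/-- … hence an `r′`-plane for every `r′ ≥ r`. [cite: Federbush1988PhaseCellIV, §11 p. 336] -/
theorem IsRPlane.mono {N : ℕ} (hN : 0 < N) {r r' : ℕ} (hr : r ≤ r') {P : Set (EuclideanSpace ℝ (Fin d))}
    (h : IsRPlane N r P) : IsRPlane N r' P := by
  induction hr with
  | refl => exact h
  | step _ ih => exact ih.succ hN

/-- «A geometric object is … *on-r* if it does [intersect some `r`-plane]». [cite: Federbush1988PhaseCellIV, §11 p. 336] -/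
def OnR (N r : ℕ) (S : Set (EuclideanSpace ℝ (Fin d))) : Prop := ∃ P, IsRPlane N r P ∧ (S ∩ P).Nonempty

/-- «A geometric object is *off-r* if it intersects no `r`-plane». [cite: Federbush1988PhaseCellIV, §11 p. 336] -/
def OffR (N r : ℕ) (S : Set (EuclideanSpace ℝ (Fin d))) : Prop := ¬OnR N r S

/-- «A geometric object, in `R⁴`, is of *depth* `r` if it intersects some `r`-plane, and no `r′`-plane with `r′ < r`. … Thus
an object is of depth `r` if it is on-`r` but off-`r′` for `r′ < r`.» [cite: Federbush1988PhaseCellIV, §11 p. 336] -/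
def HasDepth (N r : ℕ) (S : Set (EuclideanSpace ℝ (Fin d))) : Prop := OnR N r S ∧ ∀ r' < r, OffR N r' S

/-- On-`r` is inherited by finer levels: on-`r` ⇒ on-`r′` for `r′ ≥ r`. [cite: Federbush1988PhaseCellIV, §11 p. 336] -/
theorem OnR.mono {N : ℕ} (hN : 0 < N) {r r' : ℕ} (hr : r ≤ r') {S : Set (EuclideanSpace ℝ (Fin d))} (h : OnR N r S) :
    OnR N r' S := by
  obtain ⟨P, hP, hS⟩ := h
  exact ⟨P, hP.mono hN hr, hS⟩

/-- The depth of an object is unique. [cite: Federbush1988PhaseCellIV, §11 p. 336] -/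
theorem HasDepth.unique {N r₁ r₂ : ℕ} {S : Set (EuclideanSpace ℝ (Fin d))} (h₁ : HasDepth N r₁ S) (h₂ : HasDepth N r₂ S) :
    r₁ = r₂ := by
  by_contra h
  rcases lt_or_gt_of_ne h with hlt | hlt
  · exact h₂.2 r₁ hlt h₁.1
  · exact h₁.2 r₂ hlt h₂.1

/-- Every on-`r` object has a depth `≤ r` (the least level it is on). [cite: Federbush1988PhaseCellIV, §11 p. 336] -/
theorem OnR.exists_hasDepth {N r : ℕ} {S : Set (EuclideanSpace ℝ (Fin d))} (h : OnR N r S) :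
    ∃ r₀ ≤ r, HasDepth N r₀ S := by
  classical
  have hex : ∃ r₀, OnR N r₀ S := ⟨r, h⟩
  exact ⟨Nat.find hex, Nat.find_min' hex h, Nat.find_spec hex, fun r' hr' => Nat.find_min hex hr'⟩

/-- «The *height* of a vertex `v` (in any `𝒱^{r′}`) is the highest level, `r`, for which `v ∈ 𝒱^r` (under our
identifications)» — «highest level» = coarsest = least `r` (p. 321: larger `r` is «lower scale»).
[cite: Federbush1988PhaseCellIV, §11 p. 336; §1 p. 321] -/
def HasHeight (N r : ℕ) (x : EuclideanSpace ℝ (Fin d)) : Prop := x ∈ vertices d N r ∧ ∀ r' < r, x ∉ vertices d N r'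

/-- Every vertex of some `𝒱^{r′}` has a (unique) height `≤ r′`. [cite: Federbush1988PhaseCellIV, §11 p. 336] -/
theorem exists_hasHeight {N r' : ℕ} {x : EuclideanSpace ℝ (Fin d)} (hx : x ∈ vertices d N r') :
    ∃ r ≤ r', HasHeight N r x := by
  classical
  have hex : ∃ r, x ∈ vertices d N r := ⟨r', hx⟩
  exact ⟨Nat.find hex, Nat.find_min' hex hx, Nat.find_spec hex, fun r hr => Nat.find_min hex hr⟩

/-- The height is unique. [cite: Federbush1988PhaseCellIV, §11 p. 336] -/
theorem HasHeight.unique {N r₁ r₂ : ℕ} {x : EuclideanSpace ℝ (Fin d)} (h₁ : HasHeight N r₁ x) (h₂ : HasHeight N r₂ x) :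
    r₁ = r₂ := by
  by_contra h
  rcases lt_or_gt_of_ne h with hlt | hlt
  · exact h₂.2 r₁ hlt h₁.1
  · exact h₁.2 r₂ hlt h₂.1

/-! ## 9. p. 338: hypercubes of level `r`, their centres, and the Centering Property -/

/-- The (closed) hypercube of level `r` with lowest corner the vertex `n`: `{n_i/N^r ≤ x_i ≤ (n_i+1)/N^r}` («hypercube `H_i` in
`ℒ^r`», p. 336; «`H` level `r`», p. 338). [cite: Federbush1988PhaseCellIV, §11 p. 336, 338] -/
def cube (N r : ℕ) (n : Fin d → ℤ) : Set (EuclideanSpace ℝ (Fin d)) :=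
  {x | ∀ i, pos N r n i ≤ x i ∧ x i ≤ pos N r n i + edgeLen N r}

/-- «`c(H_i)` is the center of `H_i`»: `(n_i + ½)/N^r`. [cite: Federbush1988PhaseCellIV, Centering Property p. 338] -/
def center (N r : ℕ) (n : Fin d → ℤ) : EuclideanSpace ℝ (Fin d) := WithLp.toLp 2 fun i => ((n i : ℝ) + 1 / 2) * edgeLen N r

/-- Coordinates of the centre. [cite: Federbush1988PhaseCellIV, Centering Property p. 338] -/
@[simp] theorem center_apply (N r : ℕ) (n : Fin d → ℤ) (i : Fin d) : center N r n i = ((n i : ℝ) + 1 / 2) * edgeLen N r :=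
  rfl

/-- The centre lies in its cube. [cite: Federbush1988PhaseCellIV, Centering Property p. 338] -/
theorem center_mem_cube {N : ℕ} (hN : 0 < N) (r : ℕ) (n : Fin d → ℤ) : center N r n ∈ cube N r n := by
  intro i
  have hL := edgeLen_pos hN r
  simp only [center_apply, pos_apply]
  constructor <;> nlinarith

/-- **Centering Property** p. 338, verbatim: «With `H` level `r`, `d(x₀, c(H)) ≤ L_{r+1}`, if `H′` is any cube that contains
`x₀`, with level `H′ = r′ ≥ r`, then `d(x₀, c(H′)) ≤ L_{r′+1}`, where `c(H_i)` is the center of `H_i`» — for the level-`r`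
hypercube `H` with lowest corner `n` and a point `x₀` (`d` = the Euclidean distance of `R⁴`, `L_s = 1/N^s`).
[cite: Federbush1988PhaseCellIV, Centering Property p. 338] -/
def CenteringProperty (N r : ℕ) (n : Fin d → ℤ) (x₀ : EuclideanSpace ℝ (Fin d)) : Prop :=
  dist x₀ (center N r n) ≤ edgeLen N (r + 1) ∧
    ∀ r' ≥ r, ∀ n' : Fin d → ℤ, x₀ ∈ cube N r' n' → dist x₀ (center N r' n') ≤ edgeLen N (r' + 1)

/-- For ODD `N` the centre of a level-`r` cube is the centre of a level-`r′` cube for every `r′ ≥ r`: with `N^{r′−r} = 2q + 1`,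
`(n_i + ½)/N^r = (n_i N^{r′−r} + q + ½)/N^{r′}`. [cite: Federbush1988PhaseCellIV, Centering Property p. 338; §1 p. 322 («We will
choose `N` odd»)] -/
theorem center_eq_center_of_odd {N : ℕ} (hN : Odd N) {r r' : ℕ} (hr : r ≤ r') (n : Fin d → ℤ) :
    ∃ m : Fin d → ℤ, center (d := d) N r n = center N r' m := by
  obtain ⟨k, rfl⟩ := Nat.exists_eq_add_of_le hr
  obtain ⟨q, hq⟩ : Odd (N ^ k) := hN.pow
  refine ⟨fun i => n i * (N : ℤ) ^ k + q, ?_⟩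
  ext i
  have hN0 : (N : ℝ) ≠ 0 := by exact_mod_cast (Nat.pos_of_ne_zero (by rintro rfl; exact Nat.not_odd_zero hN)).ne'
  have hq' : ((N : ℝ) ^ k) = 2 * q + 1 := by exact_mod_cast hq
  simp only [center_apply, edgeLen, pow_add, mul_inv, Int.cast_add, Int.cast_mul, Int.cast_pow, Int.cast_natCast]
  field_simp
  rw [hq']
  ring

/-- A closed level-`r′` cube containing the CENTRE of a level-`r′` cube is that cube (centres are interior points; adjacent
closed cubes share only boundary). [cite: Federbush1988PhaseCellIV, Centering Property p. 338] -/
theorem eq_of_center_mem_cube {N : ℕ} (hN : 0 < N) {r : ℕ} {m n' : Fin d → ℤ} (h : center (d := d) N r m ∈ cube N r n') :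
    n' = m := by
  funext i
  obtain ⟨h1, h2⟩ := h i
  have hL := edgeLen_pos hN r
  simp only [center_apply, pos_apply] at h1 h2
  have h1' : (n' i : ℝ) ≤ m i + 1 / 2 := le_of_mul_le_mul_right (by linarith) hL
  have h2' : (m i : ℝ) + 1 / 2 ≤ n' i + 1 := le_of_mul_le_mul_right (by linarith) hL
  have h3 : n' i ≤ m i := by
    by_contra hc
    push Not at hc
    have : (m i : ℝ) + 1 ≤ n' i := by exact_mod_cast hc
    linarith
  have h4 : m i ≤ n' i := by
    by_contra hc
    push Not at hc
    have : (n' i : ℝ) + 1 ≤ m i := by exact_mod_cast hc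
    linarith
  exact le_antisymm h3 h4

/-- **The centre has the Centering Property when `N` is odd**: `x₀ = c(H)` satisfies `d(x₀, c(H)) = 0 ≤ L_{r+1}` and is the
centre of every level-`r′ ≥ r` cube containing it, so `d(x₀, c(H′)) = 0 ≤ L_{r′+1}` — print's choice «`N` odd … central
vertex» (p. 322) makes the property satisfiable for every hypercube. [cite: Federbush1988PhaseCellIV, Centering Property
p. 338; §1 p. 322] -/
theorem centeringProperty_center {N : ℕ} (hN : Odd N) (r : ℕ) (n : Fin d → ℤ) :
    CenteringProperty N r n (center N r n) := by
  have hN0 : 0 < N := Nat.pos_of_ne_zero (by rintro rfl; exact Nat.not_odd_zero hN)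
  refine ⟨by rw [dist_self]; exact (edgeLen_pos hN0 _).le, fun r' hr' n' hx => ?_⟩
  obtain ⟨m, hm⟩ := center_eq_center_of_odd hN hr' n
  rw [hm] at hx ⊢
  rw [eq_of_center_mem_cube hN0 hx, dist_self]
  exact (edgeLen_pos hN0 _).le

end PhaseCellIVLattice

end

end Literature.MathematicalPhysics.QuantumFieldTheory.Federbush1986
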